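import Literature.MathematicalPhysics.QuantumLattice.HubbardTTPrimeThermalPhaseCoexistenceCanonical
import Literature.MathematicalPhysics.QuantumLattice.HubbardTTPrimePhaseCoexistenceExclusionPeriodic
import HarnessLib

/-!
# Thermal phase separation into SUPERLATTICE-PERIODIC phases (stripes, Néel / density-wave states) is excluded by the
# same certified pressure defect as for translation-invariant phases — the `T > 0` twin of
# `HubbardTTPrimePhaseCoexistenceExclusionPeriodic`, WITHOUT any mean-entropy input

Topic `Literature/MathematicalPhysics/QuantumLattice` (family `hubbard`). Sequel of
`HubbardTTPrimeThermalPhaseCoexistenceCanonical` (a canonical thermal torus-limit state of the 2D `t–t'` Hubbard model that is a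
macroscopic mixture `λω₁ + (1−λ)ω₂` of TRANSLATION-INVARIANT states of densities `ρ₁, ρ₂` forces `p(β; ·)` affine on `[ρ₁, ρ₂]`;
a certified «pressure floor above the chord of caps» excludes it), of `HubbardTTPrimeThermalPhaseCoexistence` (the grand-canonical
twin: density jumps of coexisting phases) and of `HubbardTTPrimePhaseCoexistenceExclusionPeriodic` (hubbard-box-p3: the `T = 0`
transfer to `q`-periodic phases through the cell numbers `cellFilling` / `cellEnergy`).

THE POINT (one line of state algebra). A torus-limit thermal state `ω` — canonical (`sectorGibbs…`) or grand-canonical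
(`gcGibbs…`), indeed ANY `IsTorusLimitOfMixture` state — is translation invariant, hence equal to its own cell average
`ω.cellAverage q` for every superlattice `q` (`IsTranslationInvariant.shiftAverage_eq`); and cell averaging is AFFINE on the state
space (`shiftAverage_mix`, §1). So if `ω = λω₁ + (1−λ)ω₂` with `ωᵢ` superlattice-periodic, then ALSO
`ω = λω̄₁ + (1−λ)ω̄₂` with `ω̄ᵢ = ωᵢ.cellAverage q` TRANSLATION INVARIANT, of densities the cell fillings `ρ̄ᵢ = ωᵢ.cellFilling q`
(`IsTorusLimitOfMixture.mix_cellAverage`, §1). Every translation-invariant coexistence theorem therefore transfers VERBATIM to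
periodic phases with «density» read as «cell filling» — no affinity of the mean entropy on periodic states is needed (the
question left open in `HubbardTTPrimePhaseCoexistenceExclusionPeriodic`'s header is bypassed, not answered).

PROVED:
* §1 (every `d`, every torus-limit class) `shiftAverage_mix` / `cellAverage_mix` (averaging is affine), `IsTorusLimitOfMixture.cellAverage_eq`
  (fixed point), **`IsTorusLimitOfMixture.mix_cellAverage`** (the torus-limit mixture of two states is the same torus-limit mixture of
  their cell averages), `not_isTorusLimitOfMixture_mix_of_cellAverage` (the negative transfer) and the generic-predicate transfer
  `IsPeriodic.not_isTorusLimitOfMixture_mix_of_forall_isTranslationInvariant` (any exclusion sentence quantified over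
  translation-invariant pairs with a hypothesis on their densities holds for periodic pairs with the hypothesis on their cell fillings).
* §2 (canonical `t–t'`, `U ≥ 0`, `β > 0`) for `q`-periodic `ω₁, ω₂` with cell fillings `ρ̄₁, ρ̄₂ ∈ (0,2)`:
  coexistence in a canonical thermal state at `(β; n)` forces `n = λρ̄₁ + (1−λ)ρ̄₂`, `p(n) ≤ λp(ρ̄₁) + (1−λ)p(ρ̄₂)` and **`p(β;·)` AFFINE on
  `[ρ̄₁, ρ̄₂]`**; **certified exclusion** `IsPeriodic.not_isTorusLimitOfMixture_mix_of_chord_lt_floor` (floor `W ≤ p(n)`, caps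
  `p(ρ̄ᵢ) ≤ Qᵢ`, `λQ₁ + (1−λ)Q₂ < W` ⇒ the stripe/uniform (or stripe/stripe, Néel/uniform, …) phase-separated state is NOT a canonical
  thermal state at `(β; n)`), the strict-concavity form and the contrapositive for certificate tables.
* §3 the THRESHOLD transfer matching the certificate consumers (`Observables/PhaseSeparationExclusion*Thermal*`, hubbard-downfold-unc-2's
  hot-anchor sentences `…_of_threshold_le`): a translation-invariant «(ρ₁ ≤ r₁ | ρ₂ ≥ r₂) excluded at (β; t,t',U; n)» sentence gives the
  same sentence for `q`-periodic phases with cell fillings `ρ̄₁ ≤ r₁`, `r₂ ≤ ρ̄₂`, and (§4) for two phases with DIFFERENT period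
  lattices over the product cell (`IsPeriodic.isPeriodic_prodPeriod_left/right` of the `T = 0` file).
* §5 the grand-canonical twin: two `q`-periodic phases coexisting in a grand-canonical thermal state at `(β; μ)` have cell fillings
  obeying the translation-invariant density-jump bound `|ρ̄₁ − ρ̄₂| ≤ (Q₊ + Q₋ − 2W)/(βδ)` from three pressure certificates.

HONEST SCOPE: statements about infinite-volume torus-limit thermal states and two-component convex decompositions into
superlattice-periodic states (any common period lattice; aperiodic components are not covered); an exclusion of MACROSCOPIC
coexistence, silent on the internal structure of a single periodic phase, on `T_c`, on order. Nothing here is a certificate or a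
number. Everything is PROVED; no definition, no named fact, no `sorry`.

## Mathlib / tree search

REUSED: `shiftAverage`, `shiftAverage_expect`, `IsTranslationInvariant.shiftAverage_eq`, `cellAverage`,
`IsPeriodic.isTranslationInvariant_cellAverage` (`PeriodicStatesCellAverage`); `cellFilling_eq_density_cellAverage`
(`SuperlatticeCellEnergyFamilies`); `IsPeriodic.isPeriodic_prodPeriod_left/right` (`HubbardTTPrimePhaseCoexistenceExclusionPeriodic`);
`IsTorusLimitOfMixture.isTranslationInvariant` (`TorusLimitOfMixtures`); `mix`, `mix_expect` (`InfVolFermionState`);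
`IsTorusLimitOfMixture.density_eq_convexComb_of_mix_sectorGibbs`, `…pressureTT'_le_convexComb_of_mix_sectorGibbs`,
`…pressureTT'_eq_chord_on_segment_of_mix_sectorGibbs`, `not_isTorusLimitOfMixture_mix_of_chord_lt_floor`
(`HubbardTTPrimeThermalPhaseCoexistenceCanonical`); `IsTorusLimitOfMixture.abs_density_sub_density_le_of_mix_of_certificates`
(`HubbardTTPrimeThermalPhaseCoexistence`). `lean search 'cellAverage.*mix|shiftAverage_mix|Periodic.*TorusLimitOfMixture'`
(2026-08-28): no hits — the state-level identity `(λω₁ + (1−λ)ω₂)‾ = λω̄₁ + (1−λ)ω̄₂` was not in the tree (only its two numbers,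
`cellFilling_mix_eq_density_mix_cellAverage` / `cellEnergy_mix_eq_meanEnergy_mix_cellAverage`).
presearch: «coexistence of periodic (stripe) phases in a thermal equilibrium state ⇐ strict concavity of the pressure» →
[corpus hybrid, 6 hits: pattern-formation / phase-transition-dynamics monographs, none on lattice equilibrium states];
[galaxy «periodic states|phase separation|stripe phase», star all: none]; Israel (1979) Thm. I.2.4 states the translation-invariant
case only (as recorded in `HubbardTTPrimePhaseCoexistenceExclusionPeriodic`).

## References

* R. B. Israel, *Convexity in the Theory of Lattice Gases* (1979), Thm. I.2.4 (strict convexity and coexistence). [cite: Israel1979, Thm. I.2.4]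
* O. Bratteli, D. W. Robinson, *OAQSM 1* (1987), §4.3.1 (averages of states over a group action; the invariant states are the
  fixed points; convexity of the state space). [cite: BratteliRobinsonI1987, §4.3.1]
* V. J. Emery, S. A. Kivelson, H. Q. Lin, Phys. Rev. Lett. 64 (1990) 475–478 (phase separation vs. stripes; Maxwell
  construction). [cite: EmeryKivelsonLin1990, pp. 475–476]
* H. Araki, H. Moriya, Rev. Math. Phys. 15 (2003) 93, §4.1 Def. 4.5 (periodic states of the lattice fermion algebra). [cite: ArakiMoriya2003, §4.1 Def. 4.5]
-/

noncomputable section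

open scoped ComplexOrder BigOperators
open Finset

namespace Literature.MathematicalPhysics.QuantumLattice

open Matrix HubbardWave0 Literature.Probability.LatticeModels ThermodynamicLimit
open _root_.Filter
open scoped _root_.Topology

namespace InfVolFermionState

/-! ### §1 Cell averaging is affine, torus-limit states are its fixed points: the mixture of two states and the mixture of their
cell averages are the SAME torus-limit state (every dimension, every torus-limit class) -/

section Algebra

variable {d : ℕ} {κ : Type*} [Fintype κ] [Nonempty κ]

/-- **Averaging over finitely many translates is affine**: `(λω₁ + (1−λ)ω₂) averaged = λ(ω₁ averaged) + (1−λ)(ω₂ averaged)`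
(both sides have the same local expectations: a finite sum of convex combinations is the convex combination of the sums).
[cite: BratteliRobinsonI1987, §4.3.1] -/
theorem shiftAverage_mix (pos : κ → Site d) (s : ℝ) (hs₀ : 0 ≤ s) (hs₁ : s ≤ 1) (ω₁ ω₂ : InfVolFermionState d) :
    (InfVolFermionState.mix s hs₀ hs₁ ω₁ ω₂).shiftAverage pos =
      InfVolFermionState.mix s hs₀ hs₁ (ω₁.shiftAverage pos) (ω₂.shiftAverage pos) := by
  refine InfVolFermionState.ext fun Λ => LinearMap.ext fun A => ?_
  rw [shiftAverage_expect, mix_expect, shiftAverage_expect, shiftAverage_expect]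
  have hterm : ∀ k : κ, ((InfVolFermionState.mix s hs₀ hs₁ ω₁ ω₂).shift (pos k)).expect Λ A =
      (s : ℂ) * (ω₁.shift (pos k)).expect Λ A + ((1 - s : ℝ) : ℂ) * (ω₂.shift (pos k)).expect Λ A := fun k => by
    rw [shift_mix]; rfl
  simp only [hterm, Finset.sum_add_distrib, ← Finset.mul_sum]
  ring

/-- **Cell averaging is affine**: `(λω₁ + (1−λ)ω₂).cellAverage q = λ ω₁.cellAverage q + (1−λ) ω₂.cellAverage q` as STATES
(the two-number shadow of this identity — cell filling and cell energy — is `cellFilling_mix_eq_density_mix_cellAverage` /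
`cellEnergy_mix_eq_meanEnergy_mix_cellAverage` of the `T = 0` file). [cite: BratteliRobinsonI1987, §4.3.1] -/
theorem cellAverage_mix {q : Fin d → ℕ} (s : ℝ) (hs₀ : 0 ≤ s) (hs₁ : s ≤ 1) (ω₁ ω₂ : InfVolFermionState d) :
    (InfVolFermionState.mix s hs₀ hs₁ ω₁ ω₂).cellAverage q =
      InfVolFermionState.mix s hs₀ hs₁ (ω₁.cellAverage q) (ω₂.cellAverage q) :=
  shiftAverage_mix _ s hs₀ hs₁ ω₁ ω₂

variable {m : ℕ → ℕ} {p : ∀ L, Fin (m L) → ℝ} {ψ : ∀ L, Fin (m L) → Fock (Orb (FermionTorus d L))} {Ls : ℕ → ℕ}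

/-- **A torus-limit state is a fixed point of cell averaging** (it is translation invariant). [cite: BratteliRobinsonI1987, §4.3.1] -/
theorem IsTorusLimitOfMixture.cellAverage_eq {ω : InfVolFermionState d} (h : ω.IsTorusLimitOfMixture m p ψ Ls)
    (q : Fin d → ℕ) : ω.cellAverage q = ω :=
  h.isTranslationInvariant.shiftAverage_eq _

/-- **THE TRANSFER IDENTITY.** If the mixture `λω₁ + (1−λ)ω₂` of two ARBITRARY states is a torus-limit state (class `(m, p, ψ)`
along `Ls`), then the mixture `λω̄₁ + (1−λ)ω̄₂` of their cell averages is the same state, hence the same torus-limit state: the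
torus-limit state is translation invariant, so it equals its cell average, which is the mixture of the cell averages.
[cite: BratteliRobinsonI1987, §4.3.1] -/
theorem IsTorusLimitOfMixture.mix_cellAverage {ω₁ ω₂ : InfVolFermionState d} {s : ℝ} {hs₀ : 0 ≤ s} {hs₁ : s ≤ 1}
    (h : (InfVolFermionState.mix s hs₀ hs₁ ω₁ ω₂).IsTorusLimitOfMixture m p ψ Ls) (q : Fin d → ℕ) :
    (InfVolFermionState.mix s hs₀ hs₁ (ω₁.cellAverage q) (ω₂.cellAverage q)).IsTorusLimitOfMixture m p ψ Ls := by
  rw [← cellAverage_mix, h.cellAverage_eq q]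
  exact h

/-- The same identity as an equality of states: `λω̄₁ + (1−λ)ω̄₂ = λω₁ + (1−λ)ω₂` whenever the right-hand side is a torus-limit
state. [cite: BratteliRobinsonI1987, §4.3.1] -/
theorem IsTorusLimitOfMixture.mix_cellAverage_eq {ω₁ ω₂ : InfVolFermionState d} {s : ℝ} {hs₀ : 0 ≤ s} {hs₁ : s ≤ 1}
    (h : (InfVolFermionState.mix s hs₀ hs₁ ω₁ ω₂).IsTorusLimitOfMixture m p ψ Ls) (q : Fin d → ℕ) :
    InfVolFermionState.mix s hs₀ hs₁ (ω₁.cellAverage q) (ω₂.cellAverage q) = InfVolFermionState.mix s hs₀ hs₁ ω₁ ω₂ := by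
  rw [← cellAverage_mix, h.cellAverage_eq q]

/-- **The negative transfer**: an exclusion of the mixture of the CELL AVERAGES as a torus-limit state excludes the mixture of
the states themselves. [cite: BratteliRobinsonI1987, §4.3.1] -/
theorem not_isTorusLimitOfMixture_mix_of_cellAverage {ω₁ ω₂ : InfVolFermionState d} {s : ℝ} {hs₀ : 0 ≤ s} {hs₁ : s ≤ 1}
    (q : Fin d → ℕ)
    (h : ¬ (InfVolFermionState.mix s hs₀ hs₁ (ω₁.cellAverage q) (ω₂.cellAverage q)).IsTorusLimitOfMixture m p ψ Ls) :
    ¬ (InfVolFermionState.mix s hs₀ hs₁ ω₁ ω₂).IsTorusLimitOfMixture m p ψ Ls :=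
  fun hω => h (hω.mix_cellAverage q)

/-- **Generic-predicate transfer (every torus-limit class, every dimension).** Suppose an exclusion sentence holds for every pair
of TRANSLATION-INVARIANT states whose densities satisfy `P`: «`λω₁ + (1−λ)ω₂` is not a torus-limit state of the class `(m, p, ψ)`
along `Ls`». Then it holds for every pair of `q`-PERIODIC states whose CELL FILLINGS satisfy `P` (stripes, Néel states, density
waves; the cell averages are translation invariant with exactly these densities). [cite: BratteliRobinsonI1987, §4.3.1]
[cite: ArakiMoriya2003, §4.1 Def. 4.5] -/
theorem IsPeriodic.not_isTorusLimitOfMixture_mix_of_forall_isTranslationInvariant {P : ℝ → ℝ → Prop} {s : ℝ} {hs₀ : 0 ≤ s}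
    {hs₁ : s ≤ 1}
    (hTI : ∀ ⦃σ₁ σ₂ : InfVolFermionState d⦄, σ₁.IsTranslationInvariant → σ₂.IsTranslationInvariant →
      P σ₁.density σ₂.density → ¬ (InfVolFermionState.mix s hs₀ hs₁ σ₁ σ₂).IsTorusLimitOfMixture m p ψ Ls)
    {q : Fin d → ℕ} {ω₁ ω₂ : InfVolFermionState d} (h₁ : ω₁.IsPeriodic q) (h₂ : ω₂.IsPeriodic q)
    (hP : P (ω₁.cellFilling q) (ω₂.cellFilling q)) :
    ¬ (InfVolFermionState.mix s hs₀ hs₁ ω₁ ω₂).IsTorusLimitOfMixture m p ψ Ls := by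
  refine not_isTorusLimitOfMixture_mix_of_cellAverage q (hTI h₁.isTranslationInvariant_cellAverage
    h₂.isTranslationInvariant_cellAverage ?_)
  rwa [← ω₁.cellFilling_eq_density_cellAverage, ← ω₂.cellFilling_eq_density_cellAverage]

end Algebra

/-! ### §2 Canonical thermal states of the 2D `t–t'` Hubbard model: coexistence of PERIODIC phases and its certified exclusion -/

section Canonical

variable (t t' : ℝ) {U : ℝ} (hU : 0 ≤ U) {β : ℝ} (hβ : 0 < β) {q : Fin 2 → ℕ} {ω₁ ω₂ : InfVolFermionState 2} {Ls : ℕ → ℕ}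
  {n : ℝ}
include hU hβ

omit hU hβ in
/-- **The mean density of a canonical thermal state that separates into two periodic phases is the mixture of their CELL
FILLINGS**: `n = λρ̄(ω₁) + (1−λ)ρ̄(ω₂)`. [cite: Ruelle1969, §3.4] [cite: BratteliRobinsonI1987, §4.3.1] -/
theorem IsPeriodic.density_eq_convexComb_cellFilling_of_mix_sectorGibbs (hn0 : 0 ≤ n) (hn2 : n ≤ 2)
    {lam : ℝ} (hl0 : 0 ≤ lam) (hl1 : lam ≤ 1)
    (hω : (InfVolFermionState.mix lam hl0 hl1 ω₁ ω₂).IsTorusLimitOfMixture (sectorGibbsCount n)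
      (fun L => sectorGibbsWeightTT' β t t' U n L) (fun L => sectorGibbsVectorTT' t t' U n L) Ls)
    (hLs : Tendsto Ls atTop atTop) :
    n = lam * ω₁.cellFilling q + (1 - lam) * ω₂.cellFilling q := by
  rw [ω₁.cellFilling_eq_density_cellAverage, ω₂.cellFilling_eq_density_cellAverage]
  exact (hω.mix_cellAverage q).density_eq_convexComb_of_mix_sectorGibbs t t' hn0 hn2 hl0 hl1 hLs

/-- **Coexistence of two periodic phases forces the chord inequality for the pressure at their cell fillings**:
`p(β; n) ≤ λ p(β; ρ̄₁) + (1−λ) p(β; ρ̄₂)` (`ρ̄ᵢ = ωᵢ.cellFilling q ∈ (0,2)`, `0 < λ ≤ 1`). [cite: Israel1979, Thm. I.2.4]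
[cite: BratteliRobinsonI1987, §4.3.1] -/
theorem IsPeriodic.pressureTT'_le_convexComb_cellFilling_of_mix_sectorGibbs (h₁ : ω₁.IsPeriodic q) (h₂ : ω₂.IsPeriodic q)
    (hρ₁0 : 0 < ω₁.cellFilling q) (hρ₁2 : ω₁.cellFilling q < 2) (hρ₂0 : 0 < ω₂.cellFilling q) (hρ₂2 : ω₂.cellFilling q < 2)
    (hn0 : 0 < n) (hn2 : n < 2) {lam : ℝ} (hl0 : 0 < lam) (hl1 : lam ≤ 1)
    (hω : (InfVolFermionState.mix lam hl0.le hl1 ω₁ ω₂).IsTorusLimitOfMixture (sectorGibbsCount n)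
      (fun L => sectorGibbsWeightTT' β t t' U n L) (fun L => sectorGibbsVectorTT' t t' U n L) Ls)
    (hLs : Tendsto Ls atTop atTop) :
    pressureTT' β t t' U n ≤ lam * pressureTT' β t t' U (ω₁.cellFilling q) + (1 - lam) * pressureTT' β t t' U (ω₂.cellFilling q) := by
  rw [ω₁.cellFilling_eq_density_cellAverage, ω₂.cellFilling_eq_density_cellAverage] at *
  exact (hω.mix_cellAverage q).pressureTT'_le_convexComb_of_mix_sectorGibbs t t' hU hβ h₁.isTranslationInvariant_cellAverage
    h₂.isTranslationInvariant_cellAverage hρ₁0 hρ₁2 hρ₂0 hρ₂2 hn0 hn2 hl0 hl1 hLs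

/-- **THERMAL SEPARATION INTO TWO PERIODIC PHASES FORCES A FLAT PIECE OF THE PRESSURE–DENSITY CURVE between their cell
fillings**: `p(aρ̄₁ + bρ̄₂) = a p(ρ̄₁) + b p(ρ̄₂)` for all `a, b ≥ 0`, `a + b = 1` (`0 < λ < 1`). [cite: Israel1979, Thm. I.2.4]
[cite: EmeryKivelsonLin1990, pp. 475–476] -/
theorem IsPeriodic.pressureTT'_eq_chord_on_segment_cellFilling_of_mix_sectorGibbs (h₁ : ω₁.IsPeriodic q)
    (h₂ : ω₂.IsPeriodic q) (hρ₁0 : 0 < ω₁.cellFilling q) (hρ₁2 : ω₁.cellFilling q < 2) (hρ₂0 : 0 < ω₂.cellFilling q)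
    (hρ₂2 : ω₂.cellFilling q < 2) (hn0 : 0 < n) (hn2 : n < 2) {lam : ℝ} (hl0 : 0 < lam) (hl1 : lam < 1)
    (hω : (InfVolFermionState.mix lam hl0.le hl1.le ω₁ ω₂).IsTorusLimitOfMixture (sectorGibbsCount n)
      (fun L => sectorGibbsWeightTT' β t t' U n L) (fun L => sectorGibbsVectorTT' t t' U n L) Ls)
    (hLs : Tendsto Ls atTop atTop) {a b : ℝ} (ha : 0 ≤ a) (hb : 0 ≤ b) (hab : a + b = 1) :
    pressureTT' β t t' U (a * ω₁.cellFilling q + b * ω₂.cellFilling q) =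
      a * pressureTT' β t t' U (ω₁.cellFilling q) + b * pressureTT' β t t' U (ω₂.cellFilling q) := by
  rw [ω₁.cellFilling_eq_density_cellAverage, ω₂.cellFilling_eq_density_cellAverage] at *
  exact (hω.mix_cellAverage q).pressureTT'_eq_chord_on_segment_of_mix_sectorGibbs t t' hU hβ
    h₁.isTranslationInvariant_cellAverage h₂.isTranslationInvariant_cellAverage hρ₁0 hρ₁2 hρ₂0 hρ₂2 hn0 hn2 hl0 hl1 hLs ha hb hab

/-- **CERTIFIED EXCLUSION OF THERMAL PHASE SEPARATION INTO TWO PERIODIC PHASES.** `U ≥ 0`, `β > 0`; `ω₁, ω₂` `q`-periodic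
(stripes, Néel / density-wave states, any superlattice order with a common period lattice) with cell fillings `ρ̄₁, ρ̄₂ ∈ (0,2)`,
`0 < λ ≤ 1`; a certified pressure FLOOR `W ≤ p(β; n)` at `n`, certified CAPS `p(β; ρ̄₁) ≤ Q₁`, `p(β; ρ̄₂) ≤ Q₂` with
`λQ₁ + (1−λ)Q₂ < W`. Then the phase-separated state `λω₁ + (1−λ)ω₂` is NOT a canonical thermal torus-limit state at
`(β; t,t',U; n)` along any `Ls → ∞`. [cite: Israel1979, Thm. I.2.4] [cite: EmeryKivelsonLin1990, pp. 475–476] -/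
theorem IsPeriodic.not_isTorusLimitOfMixture_mix_of_chord_lt_floor (h₁ : ω₁.IsPeriodic q) (h₂ : ω₂.IsPeriodic q)
    (hρ₁0 : 0 < ω₁.cellFilling q) (hρ₁2 : ω₁.cellFilling q < 2) (hρ₂0 : 0 < ω₂.cellFilling q) (hρ₂2 : ω₂.cellFilling q < 2)
    (hn0 : 0 < n) (hn2 : n < 2) {lam : ℝ} (hl0 : 0 < lam) (hl1 : lam ≤ 1) (hLs : Tendsto Ls atTop atTop) {W Q₁ Q₂ : ℝ}
    (hW : W ≤ pressureTT' β t t' U n) (hQ₁ : pressureTT' β t t' U (ω₁.cellFilling q) ≤ Q₁)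
    (hQ₂ : pressureTT' β t t' U (ω₂.cellFilling q) ≤ Q₂) (hgap : lam * Q₁ + (1 - lam) * Q₂ < W) :
    ¬ (InfVolFermionState.mix lam hl0.le hl1 ω₁ ω₂).IsTorusLimitOfMixture (sectorGibbsCount n)
      (fun L => sectorGibbsWeightTT' β t t' U n L) (fun L => sectorGibbsVectorTT' t t' U n L) Ls := by
  rw [ω₁.cellFilling_eq_density_cellAverage, ω₂.cellFilling_eq_density_cellAverage] at *
  exact not_isTorusLimitOfMixture_mix_of_cellAverage q
    (InfVolFermionState.not_isTorusLimitOfMixture_mix_of_chord_lt_floor t t' hU hβ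
      h₁.isTranslationInvariant_cellAverage h₂.isTranslationInvariant_cellAverage hρ₁0 hρ₁2 hρ₂0 hρ₂2 hn0 hn2 hl0 hl1 hLs hW hQ₁
      hQ₂ hgap)

/-- **Exclusion from strict concavity at the point** (no certificates named): `λ p(ρ̄₁) + (1−λ) p(ρ̄₂) < p(n)` ⇒ the
phase-separated state of the two periodic phases is not a canonical thermal state at `(β; n)`. [cite: Israel1979, Thm. I.2.4] -/
theorem IsPeriodic.not_isTorusLimitOfMixture_mix_of_lt_at (h₁ : ω₁.IsPeriodic q) (h₂ : ω₂.IsPeriodic q)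
    (hρ₁0 : 0 < ω₁.cellFilling q) (hρ₁2 : ω₁.cellFilling q < 2) (hρ₂0 : 0 < ω₂.cellFilling q) (hρ₂2 : ω₂.cellFilling q < 2)
    (hn0 : 0 < n) (hn2 : n < 2) {lam : ℝ} (hl0 : 0 < lam) (hl1 : lam ≤ 1) (hLs : Tendsto Ls atTop atTop)
    (hlt : lam * pressureTT' β t t' U (ω₁.cellFilling q) + (1 - lam) * pressureTT' β t t' U (ω₂.cellFilling q) <
      pressureTT' β t t' U n) :
    ¬ (InfVolFermionState.mix lam hl0.le hl1 ω₁ ω₂).IsTorusLimitOfMixture (sectorGibbsCount n)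
      (fun L => sectorGibbsWeightTT' β t t' U n L) (fun L => sectorGibbsVectorTT' t t' U n L) Ls :=
  IsPeriodic.not_isTorusLimitOfMixture_mix_of_chord_lt_floor t t' hU hβ h₁ h₂ hρ₁0 hρ₁2 hρ₂0 hρ₂2 hn0 hn2 hl0 hl1 hLs le_rfl
    le_rfl le_rfl hlt

/-- **Contrapositive reading for certificate tables**: if the phase-separated state of two periodic phases IS a canonical thermal
state at `(β; n)`, every floor/cap triple at `(n; ρ̄₁, ρ̄₂)` obeys `W ≤ λQ₁ + (1−λ)Q₂`. [cite: Israel1979, Thm. I.2.4] -/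
theorem IsPeriodic.floor_le_convexComb_caps_of_mix_sectorGibbs (h₁ : ω₁.IsPeriodic q) (h₂ : ω₂.IsPeriodic q)
    (hρ₁0 : 0 < ω₁.cellFilling q) (hρ₁2 : ω₁.cellFilling q < 2) (hρ₂0 : 0 < ω₂.cellFilling q) (hρ₂2 : ω₂.cellFilling q < 2)
    (hn0 : 0 < n) (hn2 : n < 2) {lam : ℝ} (hl0 : 0 < lam) (hl1 : lam ≤ 1)
    (hω : (InfVolFermionState.mix lam hl0.le hl1 ω₁ ω₂).IsTorusLimitOfMixture (sectorGibbsCount n)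
      (fun L => sectorGibbsWeightTT' β t t' U n L) (fun L => sectorGibbsVectorTT' t t' U n L) Ls)
    (hLs : Tendsto Ls atTop atTop) {W Q₁ Q₂ : ℝ} (hW : W ≤ pressureTT' β t t' U n)
    (hQ₁ : pressureTT' β t t' U (ω₁.cellFilling q) ≤ Q₁) (hQ₂ : pressureTT' β t t' U (ω₂.cellFilling q) ≤ Q₂) :
    W ≤ lam * Q₁ + (1 - lam) * Q₂ := by
  by_contra hlt
  exact IsPeriodic.not_isTorusLimitOfMixture_mix_of_chord_lt_floor t t' hU hβ h₁ h₂ hρ₁0 hρ₁2 hρ₂0 hρ₂2 hn0 hn2 hl0 hl1 hLs hW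
    hQ₁ hQ₂ (lt_of_not_ge hlt) hω

end Canonical

/-! ### §3 The threshold transfer used by the certificate files («(ρ₁ ≤ r₁ | ρ₂ ≥ r₂) excluded at (β; t,t',U; n)») -/

section Threshold

variable {β t t' U n : ℝ} {Ls : ℕ → ℕ}

/-- **Threshold transfer to periodic phases (canonical class).** Suppose that at `(β; t,t',U; n)` NO canonical thermal state is a
mixture `λω₁ + (1−λ)ω₂` (`0 < λ < 1`) of translation-invariant states with `0 < ρ(ω₁) ≤ r₁` and `r₂ ≤ ρ(ω₂) < 2` (the shape of
`Observables/PhaseSeparationExclusion*Thermal*`). Then no canonical thermal state there is a mixture of two `q`-PERIODIC states with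
cell fillings `0 < ρ̄(ω₁) ≤ r₁`, `r₂ ≤ ρ̄(ω₂) < 2` — the same competing-order word with «stripe / Néel / density-wave phase» allowed
as either component. [cite: Israel1979, Thm. I.2.4] [cite: BratteliRobinsonI1987, §4.3.1] -/
theorem IsPeriodic.not_isTorusLimitOfMixture_sectorGibbs_mix_of_forall_isTranslationInvariant_thresholds {r₁ r₂ : ℝ}
    (hTI : ∀ ⦃σ₁ σ₂ : InfVolFermionState 2⦄, σ₁.IsTranslationInvariant → σ₂.IsTranslationInvariant →
      0 < σ₁.density → σ₁.density ≤ r₁ → r₂ ≤ σ₂.density → σ₂.density < 2 → ∀ ⦃lam : ℝ⦄ (hl0 : 0 < lam) (hl1 : lam < 1),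
      ¬ (InfVolFermionState.mix lam hl0.le hl1.le σ₁ σ₂).IsTorusLimitOfMixture (sectorGibbsCount n)
        (fun L => sectorGibbsWeightTT' β t t' U n L) (fun L => sectorGibbsVectorTT' t t' U n L) Ls)
    {q : Fin 2 → ℕ} {ω₁ ω₂ : InfVolFermionState 2} (h₁ : ω₁.IsPeriodic q) (h₂ : ω₂.IsPeriodic q)
    (hρ₁ : 0 < ω₁.cellFilling q) (hρ₁' : ω₁.cellFilling q ≤ r₁) (hρ₂ : r₂ ≤ ω₂.cellFilling q) (hρ₂' : ω₂.cellFilling q < 2)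
    {lam : ℝ} (hl0 : 0 < lam) (hl1 : lam < 1) :
    ¬ (InfVolFermionState.mix lam hl0.le hl1.le ω₁ ω₂).IsTorusLimitOfMixture (sectorGibbsCount n)
      (fun L => sectorGibbsWeightTT' β t t' U n L) (fun L => sectorGibbsVectorTT' t t' U n L) Ls :=
  IsPeriodic.not_isTorusLimitOfMixture_mix_of_forall_isTranslationInvariant
    (P := fun x y => 0 < x ∧ x ≤ r₁ ∧ r₂ ≤ y ∧ y < 2)
    (fun _ _ hσ₁ hσ₂ hP => hTI hσ₁ hσ₂ hP.1 hP.2.1 hP.2.2.1 hP.2.2.2 hl0 hl1) h₁ h₂ ⟨hρ₁, hρ₁', hρ₂, hρ₂'⟩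

/-! ### §4 Two phases with DIFFERENT period lattices: read the cell fillings over the product cell -/

/-- **Threshold transfer to a `q₁`-periodic and a `q₂`-periodic phase** (both are periodic under the product lattice
`Q_i + 1 = (q₁_i + 1)(q₂_i + 1)`, `IsPeriodic.isPeriodic_prodPeriod_left/right`): the translation-invariant
«(ρ₁ ≤ r₁ | ρ₂ ≥ r₂) excluded» sentence excludes their coexistence in a canonical thermal state whenever the cell fillings over the
product cell satisfy `0 < ρ̄(ω₁) ≤ r₁`, `r₂ ≤ ρ̄(ω₂) < 2`. [cite: Israel1979, Thm. I.2.4] [cite: ArakiMoriya2003, §4.1 Def. 4.5] -/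
theorem IsPeriodic.not_isTorusLimitOfMixture_sectorGibbs_mix_of_forall_isTranslationInvariant_thresholds₂ {r₁ r₂ : ℝ}
    (hTI : ∀ ⦃σ₁ σ₂ : InfVolFermionState 2⦄, σ₁.IsTranslationInvariant → σ₂.IsTranslationInvariant →
      0 < σ₁.density → σ₁.density ≤ r₁ → r₂ ≤ σ₂.density → σ₂.density < 2 → ∀ ⦃lam : ℝ⦄ (hl0 : 0 < lam) (hl1 : lam < 1),
      ¬ (InfVolFermionState.mix lam hl0.le hl1.le σ₁ σ₂).IsTorusLimitOfMixture (sectorGibbsCount n)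
        (fun L => sectorGibbsWeightTT' β t t' U n L) (fun L => sectorGibbsVectorTT' t t' U n L) Ls)
    {q₁ q₂ : Fin 2 → ℕ} {ω₁ ω₂ : InfVolFermionState 2} (h₁ : ω₁.IsPeriodic q₁) (h₂ : ω₂.IsPeriodic q₂)
    (hρ₁ : 0 < ω₁.cellFilling (fun j => (q₁ j + 1) * (q₂ j + 1) - 1))
    (hρ₁' : ω₁.cellFilling (fun j => (q₁ j + 1) * (q₂ j + 1) - 1) ≤ r₁)
    (hρ₂ : r₂ ≤ ω₂.cellFilling (fun j => (q₁ j + 1) * (q₂ j + 1) - 1))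
    (hρ₂' : ω₂.cellFilling (fun j => (q₁ j + 1) * (q₂ j + 1) - 1) < 2)
    {lam : ℝ} (hl0 : 0 < lam) (hl1 : lam < 1) :
    ¬ (InfVolFermionState.mix lam hl0.le hl1.le ω₁ ω₂).IsTorusLimitOfMixture (sectorGibbsCount n)
      (fun L => sectorGibbsWeightTT' β t t' U n L) (fun L => sectorGibbsVectorTT' t t' U n L) Ls :=
  IsPeriodic.not_isTorusLimitOfMixture_sectorGibbs_mix_of_forall_isTranslationInvariant_thresholds hTI
    h₁.isPeriodic_prodPeriod_left h₂.isPeriodic_prodPeriod_right hρ₁ hρ₁' hρ₂ hρ₂' hl0 hl1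

end Threshold

/-! ### §5 Grand-canonical twin: the cell fillings of two coexisting periodic phases obey the density-jump bound -/

section GrandCanonical

variable {β : ℝ} (hβ : 0 ≤ β) (t t' : ℝ) {U : ℝ} (hU : 0 ≤ U) (μ hz : ℝ)
  {q : Fin 2 → ℕ} {ω₁ ω₂ : InfVolFermionState 2} {Ls : ℕ → ℕ}
include hβ hU

/-- **Certified density-jump bound for coexisting PERIODIC phases (grand-canonical).** `β > 0`; `ω₁, ω₂` `q`-periodic; the
mixture `λω₁ + (1−λ)ω₂` (`0 < λ < 1`) a grand-canonical thermal torus-limit state at `(β; t,t',U; μ, h)`; a floor `W ≤ P(μ)` and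
ceilings `P(μ+δ) ≤ Q₊`, `P(μ−δ) ≤ Q₋` (`δ > 0`). Then the CELL FILLINGS of the two phases differ by at most `(Q₊ + Q₋ − 2W)/(βδ)` —
the translation-invariant density-jump bound read on the cell averages. [cite: Israel1979, Thm. I.2.4] [cite: Griffiths1964] -/
theorem IsPeriodic.abs_cellFilling_sub_cellFilling_le_of_mix_of_certificates (hβ' : 0 < β) (h₁ : ω₁.IsPeriodic q)
    (h₂ : ω₂.IsPeriodic q) {lam : ℝ} (hl0 : 0 < lam) (hl1 : lam < 1)
    (hω : (InfVolFermionState.mix lam hl0.le hl1.le ω₁ ω₂).IsTorusLimitOfMixture sourcedGibbsCount (gcGibbsWeightTT' β t t' U μ hz)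
      (gcGibbsVectorTT' t t' U μ hz) Ls)
    (hLs : Tendsto Ls atTop atTop) {δ W Qp Qm : ℝ} (hδ : 0 < δ) (hW : W ≤ gcPressureTT'Zeeman β t t' U μ hz)
    (hQp : gcPressureTT'Zeeman β t t' U (μ + δ) hz ≤ Qp) (hQm : gcPressureTT'Zeeman β t t' U (μ - δ) hz ≤ Qm) :
    |ω₁.cellFilling q - ω₂.cellFilling q| ≤ (Qp + Qm - 2 * W) / (β * δ) := by
  rw [ω₁.cellFilling_eq_density_cellAverage, ω₂.cellFilling_eq_density_cellAverage]
  exact (hω.mix_cellAverage q).abs_density_sub_density_le_of_mix_of_certificates hβ t t' hU μ hz hβ'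
    h₁.isTranslationInvariant_cellAverage h₂.isTranslationInvariant_cellAverage hl0 hl1 hLs hδ hW hQp hQm

end GrandCanonical

end InfVolFermionState

end Literature.MathematicalPhysics.QuantumLattice

end
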